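import Summits.HodgeConjecture.CorCM.Census.CyclicCharacterFlipOrbit
import Summits.HodgeConjecture.CorCM.Census.TwoAdicSplittingTraceResidual

/-!
# Cyclic characters, XIII: THE REPAIRED META THEOREMS — `μ(G, c) = φ₂(G, c)` from a cover, the flip-orbit reductions, one fibre sum and a count

COR-CM (cell `pub-hodgecm2`), count-neutral kernel combinatorics by the binder seat b09 (gen 42; lane CYCLIC-CHARACTER FIBRE LAW, part XIII), on part XII
(`Census/CyclicCharacterFlipOrbit.two_pow_smul_mem_psp_of_single_flips'`), gen 38ʼs two-adic splitting (`Census/TwoAdicSplitting.isLeast_card_gfaces_generate_of_isPGroup`),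
gen 40ʼs relative splitting (`Census/TwoAdicSplittingRelative.…_rel`) and group-free residual criterion
(`Census/TwoAdicSplittingTraceResidual.isLeast_card_gfaces_generate_of_cover_of_supported`), all BY NAME.  Theorems only (no definition, no `decide`, no
certificate, no named fact, no `sorry`).
HONEST FRAMING: `HC_CM` is NOT proved, here or anywhere in the tree; nothing here is a period or a headline.

WHY A RE-ISSUE.  Part X (`Census/CyclicCharacterArcMeta.lean`, gen 41) stated three META theorems on the hypothesis `hflip` — reduction of the single flips
onto the ARC BLOCK ALONE — which part XI (`Census/CyclicCharacterArcObstruction.lean`) proved UNSATISFIABLE whenever `ker w ≠ 1`.  This file states the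
same three theorems on the REPAIRED hypotheses of part XII, which are satisfiable (indeed automatic for `L = hodgeSpan`, by the type-sum count: the arc
block together with one flip orbit has full type-sum rank, and a fibre sum of single flips has the type sum of `[T_1] + (|ker w| − 1)[T_0]`):

A finite face family `S₀` is a REPAIRED ARC-TYPE CERTIFICATE (for a chosen `s₀ ∈ T_0`) if
  (cov)   every type reduces INTEGRALLY, modulo `ℤ⟨pairs⟩ + ℤ[G]·S₀`, to the types of potential `≤ 1` w.r.t. the arc block (gen 38ʼs cover inside `S₀`);
  (flip′) every SINGLE FLIP `T_0^{(s)}` reduces, modulo the same lattice and up to `2ʲ`, onto the arc block TOGETHER WITH the flip orbit `{T_0^{(s₀)}·Q⁻¹}`;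
  (fib)   the fibre sum `Σ_{w Q = 0} [T_0^{(s₀)}·Q⁻¹]` reduces, modulo the same lattice and up to `2^{j'}`, onto the arc block;
  (ind)   `S₀` is fibre-independent.
Then:
* §1 **2-GROUPS** (`isLeast_card_gfaces_generate_of_flipCert_isPGroup`): `μ(G, c) = φ₂(G, c)`.
* §2 **ANY GROUP, relative form** (`…_of_flipCert_rel`): plus a factorisation `G = ι(Γ)·⟨N⟩` (`Γ` a `2`-group) and the `N`-coboundary condition mod `2`.
* §3 **ANY GROUP, group-free form** (`…_of_flipCert_supported`): plus mod-`2` generation of the Hodge vectors supported on the near zone; then also `|S₀| = φ₂`.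

## References
* [Pohlmann1968] H. Pohlmann, Algebraic cycles on abelian varieties of complex multiplication type, Ann. of Math. 88 (1968), Thm 1.
* [Milne1999] J. S. Milne, Lefschetz motives and the Tate conjecture, Compositio Math. 117 (1999), Prop. 2.1, p. 54.
-/

namespace Summit.HodgeConjecture.CorCM.Census.CyclicCharacter

open Finset
open Summit.HodgeConjecture.CorCM.Prior.AllgGroup.RfwfAllgGroup
open Summit.HodgeConjecture.CorCM.Census.BlockParity
open Summit.HodgeConjecture.CorCM.Census.Coinvariant
open Summit.HodgeConjecture.CorCM.Census.BaseBlock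
open Summit.HodgeConjecture.CorCM.Census.Splitting

noncomputable section

variable {G : Type*} [Group G] [Fintype G] [DecidableEq G] {k : ℕ} {w : G → ZMod (2 ^ k)} {c : G}

/-! ## §1 Two-groups: a repaired arc-type certificate gives the law -/

/-- **REPAIRED ARC-TYPE META THEOREM FOR 2-GROUPS: `μ(G, c) = φ₂(G, c)`** from a fibre-independent face family containing a cover of the arc block,
reducing the single flips of `T_0` onto the arc block plus one flip orbit up to `2ʲ`, and reducing the fibre sum of that orbit onto the arc block up to
`2^{j'}`. [folklore] -/
theorem isLeast_card_gfaces_generate_of_flipCert_isPGroup [Fintype (CMF G c)] (hG : IsPGroup 2 G) (hw : ∀ P Q : G, w (P * Q) = w P + w Q)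
    (hk : 1 ≤ k) (hc2 : c * c = 1) (hcen : ∀ x : G, x * c = c * x) (hwc : w c ≠ 0) (h1 : ∃ g₁ : G, w g₁ = 1) {s₀ : G}
    (hs₀ : s₀ ∈ (arcType hw hk hc2 hwc 0).1)
    (S₀ : Finset (CMF G c →₀ ℤ)) (hS₀ : (↑S₀ : Set (CMF G c →₀ ℤ)) ⊆ gfaceSet G c hc2)
    (hli : LinearIndepOn (ZMod 2) (fun f : CMF G c →₀ ℤ => (rad2 c hc2).mkQ (red c f)) ↑S₀) (j j' : ℕ)
    (hcov : ∀ Φ : CMF G c, Finsupp.single Φ (1 : ℤ) ∈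
      (Submodule.span ℤ (pairSet c) ⊔ Submodule.span ℤ (translates c S₀)) ⊔
        Submodule.span ℤ ((fun Ψ => Finsupp.single Ψ (1 : ℤ)) '' {Ψ : CMF G c | bpot c (arcType hw hk hc2 hwc 0) Ψ ≤ 1}))
    (hflip : ∀ s ∈ (arcType hw hk hc2 hwc 0).1, ((2 : ℤ) ^ j) • Finsupp.single (oflipCM c hc2 s (arcType hw hk hc2 hwc 0)) (1 : ℤ) ∈
      ((Submodule.span ℤ (pairSet c) ⊔ Submodule.span ℤ (translates c S₀)) ⊔
        Submodule.span ℤ (Set.range fun Q : G => Finsupp.single (rt c Q (arcType hw hk hc2 hwc 0)) (1 : ℤ))) ⊔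
          Submodule.span ℤ (Set.range fun Q : G => Finsupp.single (rt c Q (oflipCM c hc2 s₀ (arcType hw hk hc2 hwc 0))) (1 : ℤ)))
    (hfib₀ : ((2 : ℤ) ^ j') •
      (∑ Q ∈ univ.filter (fun Q => w Q = 0), Finsupp.single (rt c Q (oflipCM c hc2 s₀ (arcType hw hk hc2 hwc 0))) (1 : ℤ)) ∈
        (Submodule.span ℤ (pairSet c) ⊔ Submodule.span ℤ (translates c S₀)) ⊔
          Submodule.span ℤ (Set.range fun Q : G => Finsupp.single (rt c Q (arcType hw hk hc2 hwc 0)) (1 : ℤ))) :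
    IsLeast {n : ℕ | ∃ S : Finset (CMF G c →₀ ℤ), (↑S ⊆ gfaceSet G c hc2) ∧ S.card = n ∧
      hodgeSpan c hc2 ≤ Submodule.span ℤ (pairSet c) ⊔ Submodule.span ℤ (translates c S)} (fibreTwo c hc2) :=
  isLeast_card_gfaces_generate_of_isPGroup c hG hc2 (c_ne_one hw hwc) hcen S₀ hS₀ hli (j' + j)
    (two_pow_smul_mem_psp_of_single_flips' hw hk hc2 hcen hwc h1 hs₀ S₀ (hS₀.trans (gfaceSet_subset_hodgeSpan c hc2)) j j' hcov hflip hfib₀)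

/-! ## §2 Any group, relative form: plus a `2`-group factorisation and the `N`-coboundaries -/

/-- **REPAIRED ARC-TYPE META THEOREM, RELATIVE FORM: `μ(G, c) = φ₂(G, c)`** for `G = ι(Γ)·⟨N⟩` (`Γ` a `2`-group) from a repaired arc-type certificate whose
target contains the `N`-coboundaries of the faces mod `2` — the metacyclic column `ℤ/m ⋊ ℤ/2ᵏ` (`Γ = ℤ/2ᵏ`, `N` a generator of `ℤ/m`). [folklore] -/
theorem isLeast_card_gfaces_generate_of_flipCert_rel [Fintype (CMF G c)] {Γ : Type*} [Group Γ] (hΓ : IsPGroup 2 Γ) (ι : Γ →* G) (N : Set G)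
    (hfac : ∀ Q : G, ∃ γ : Γ, ∃ n ∈ Subgroup.closure N, Q = ι γ * n)
    (hw : ∀ P Q : G, w (P * Q) = w P + w Q) (hk : 1 ≤ k) (hc2 : c * c = 1) (hcen : ∀ x : G, x * c = c * x) (hwc : w c ≠ 0)
    (h1 : ∃ g₁ : G, w g₁ = 1) {s₀ : G} (hs₀ : s₀ ∈ (arcType hw hk hc2 hwc 0).1)
    (S₀ : Finset (CMF G c →₀ ℤ)) (hS₀ : (↑S₀ : Set (CMF G c →₀ ℤ)) ⊆ gfaceSet G c hc2)
    (hli : LinearIndepOn (ZMod 2) (fun f : CMF G c →₀ ℤ => (rad2 c hc2).mkQ (red c f)) ↑S₀)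
    (hN : ∀ n ∈ N, ∀ f ∈ gfaceSet G c hc2, red c (Finsupp.mapDomain (rt c n) f - f) ∈
      pair2 c ⊔ Submodule.span (ZMod 2) (translates2 c (S₀.image (red c)))) (j j' : ℕ)
    (hcov : ∀ Φ : CMF G c, Finsupp.single Φ (1 : ℤ) ∈
      (Submodule.span ℤ (pairSet c) ⊔ Submodule.span ℤ (translates c S₀)) ⊔
        Submodule.span ℤ ((fun Ψ => Finsupp.single Ψ (1 : ℤ)) '' {Ψ : CMF G c | bpot c (arcType hw hk hc2 hwc 0) Ψ ≤ 1}))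
    (hflip : ∀ s ∈ (arcType hw hk hc2 hwc 0).1, ((2 : ℤ) ^ j) • Finsupp.single (oflipCM c hc2 s (arcType hw hk hc2 hwc 0)) (1 : ℤ) ∈
      ((Submodule.span ℤ (pairSet c) ⊔ Submodule.span ℤ (translates c S₀)) ⊔
        Submodule.span ℤ (Set.range fun Q : G => Finsupp.single (rt c Q (arcType hw hk hc2 hwc 0)) (1 : ℤ))) ⊔
          Submodule.span ℤ (Set.range fun Q : G => Finsupp.single (rt c Q (oflipCM c hc2 s₀ (arcType hw hk hc2 hwc 0))) (1 : ℤ)))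
    (hfib₀ : ((2 : ℤ) ^ j') •
      (∑ Q ∈ univ.filter (fun Q => w Q = 0), Finsupp.single (rt c Q (oflipCM c hc2 s₀ (arcType hw hk hc2 hwc 0))) (1 : ℤ)) ∈
        (Submodule.span ℤ (pairSet c) ⊔ Submodule.span ℤ (translates c S₀)) ⊔
          Submodule.span ℤ (Set.range fun Q : G => Finsupp.single (rt c Q (arcType hw hk hc2 hwc 0)) (1 : ℤ))) :
    IsLeast {n : ℕ | ∃ S : Finset (CMF G c →₀ ℤ), (↑S ⊆ gfaceSet G c hc2) ∧ S.card = n ∧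
      hodgeSpan c hc2 ≤ Submodule.span ℤ (pairSet c) ⊔ Submodule.span ℤ (translates c S)} (fibreTwo c hc2) :=
  isLeast_card_gfaces_generate_of_isPGroup_rel c hΓ ι N hfac hc2 (c_ne_one hw hwc) hcen S₀ hS₀ hli hN (j' + j)
    (two_pow_smul_mem_psp_of_single_flips' hw hk hc2 hcen hwc h1 hs₀ S₀ (hS₀.trans (gfaceSet_subset_hodgeSpan c hc2)) j j' hcov hflip hfib₀)

/-! ## §3 Any group, group-free form: plus mod-`2` generation of the near zone -/

/-- **REPAIRED ARC-TYPE META THEOREM, GROUP-FREE FORM: `|S₀| = φ₂(G, c)` and `μ(G, c) = φ₂(G, c)`** from a repaired arc-type certificate which moreover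
generates mod `2` every Hodge vector mod `2` supported on the near zone (potential `≤ 1`) — any finite `G`. [folklore] -/
theorem isLeast_card_gfaces_generate_of_flipCert_supported [Fintype (CMF G c)] (hw : ∀ P Q : G, w (P * Q) = w P + w Q) (hk : 1 ≤ k)
    (hc2 : c * c = 1) (hcen : ∀ x : G, x * c = c * x) (hwc : w c ≠ 0) (h1 : ∃ g₁ : G, w g₁ = 1) {s₀ : G}
    (hs₀ : s₀ ∈ (arcType hw hk hc2 hwc 0).1)
    (S₀ : Finset (CMF G c →₀ ℤ)) (hS₀ : (↑S₀ : Set (CMF G c →₀ ℤ)) ⊆ gfaceSet G c hc2)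
    (hli : LinearIndepOn (ZMod 2) (fun f : CMF G c →₀ ℤ => (rad2 c hc2).mkQ (red c f)) ↑S₀) (j j' : ℕ)
    (hcov : ∀ Φ : CMF G c, Finsupp.single Φ (1 : ℤ) ∈
      (Submodule.span ℤ (pairSet c) ⊔ Submodule.span ℤ (translates c S₀)) ⊔
        Submodule.span ℤ ((fun Ψ => Finsupp.single Ψ (1 : ℤ)) '' {Ψ : CMF G c | bpot c (arcType hw hk hc2 hwc 0) Ψ ≤ 1}))
    (hres : ∀ y ∈ hodge2 c hc2, y ∈ Finsupp.supported (ZMod 2) (ZMod 2) {Ψ : CMF G c | bpot c (arcType hw hk hc2 hwc 0) Ψ ≤ 1} →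
      y ∈ pair2 c ⊔ Submodule.span (ZMod 2) (translates2 c (S₀.image (red c))))
    (hflip : ∀ s ∈ (arcType hw hk hc2 hwc 0).1, ((2 : ℤ) ^ j) • Finsupp.single (oflipCM c hc2 s (arcType hw hk hc2 hwc 0)) (1 : ℤ) ∈
      ((Submodule.span ℤ (pairSet c) ⊔ Submodule.span ℤ (translates c S₀)) ⊔
        Submodule.span ℤ (Set.range fun Q : G => Finsupp.single (rt c Q (arcType hw hk hc2 hwc 0)) (1 : ℤ))) ⊔
          Submodule.span ℤ (Set.range fun Q : G => Finsupp.single (rt c Q (oflipCM c hc2 s₀ (arcType hw hk hc2 hwc 0))) (1 : ℤ)))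
    (hfib₀ : ((2 : ℤ) ^ j') •
      (∑ Q ∈ univ.filter (fun Q => w Q = 0), Finsupp.single (rt c Q (oflipCM c hc2 s₀ (arcType hw hk hc2 hwc 0))) (1 : ℤ)) ∈
        (Submodule.span ℤ (pairSet c) ⊔ Submodule.span ℤ (translates c S₀)) ⊔
          Submodule.span ℤ (Set.range fun Q : G => Finsupp.single (rt c Q (arcType hw hk hc2 hwc 0)) (1 : ℤ))) :
    S₀.card = fibreTwo c hc2 ∧
    IsLeast {n : ℕ | ∃ S : Finset (CMF G c →₀ ℤ), (↑S ⊆ gfaceSet G c hc2) ∧ S.card = n ∧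
      hodgeSpan c hc2 ≤ Submodule.span ℤ (pairSet c) ⊔ Submodule.span ℤ (translates c S)} (fibreTwo c hc2) :=
  isLeast_card_gfaces_generate_of_cover_of_supported c hc2 (c_ne_one hw hwc) hcen S₀ hS₀ hli _ hcov hres (j' + j)
    (two_pow_smul_mem_psp_of_single_flips' hw hk hc2 hcen hwc h1 hs₀ S₀ (hS₀.trans (gfaceSet_subset_hodgeSpan c hc2)) j j' hcov hflip hfib₀)

end

end Summit.HodgeConjecture.CorCM.Census.CyclicCharacter
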